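import Literature.Probability.Percolation.SlabMSFNoNewCircuitW
import Literature.Probability.Percolation.SlabMSFStatement
import Literature.Probability.Percolation.InvasionPercolation
import HarnessLib

/-!
# Newman–Tassion–Wu 2017, §4 (proof of Theorem 2.4) — the geometry of the gluing lemma for
# invasion, III: the landing data `z(ω)`, `w(ω)` and the piece data of the surgery

Topic: `Literature/Probability/Percolation`.  Fourth geometry file of the port of NTW's Lemma 4.1
(*Critical percolation and the minimal spanning tree in slabs*, CPAM 70 (2017) = arXiv:1512.09107,
§4.1, pp. 20–21), after `SlabMSFInside.lean` (`R`, `∂R`, `R ∖ ∂R`), `SlabMSFConnector.lean` (the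
landing column `z′`, the connectors `Γ_z`, `Γ_w`, the plus cylinder `B̄₁^#(z′)`) and
`SlabMSFNoNewCircuit(W).lean` (the surgered configurations `cfgZ`, `cfgZW`, the modified pair set
`surgS`).  This file names, as functions of the label field `U : Sym2 (slab 3 k) → ℝ` driving the
tree's vertex invasion (`Invasion.invasion`, `Invasion.exitIndex`, `Invasion.exitVertex`,
`InvasionPercolation.lean`), the two random vertices of NTW's construction and the finite sets
they are read from:

* `NTW17.insideFin k Γ N` — `R ∖ ∂R` as a `Finset` (the vertices of `R ∖ ∂R` over `B_N`; equal to
  `R ∖ ∂R` when `Γ` is a surrounding open circuit of `Ā_{n,N}`, `coe_insideFin`);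
* `NTW17.zHat k Γ N U a` — **`z(ω)`**, "the first landing point of `𝓘_0` on `∂R`": the break-out
  vertex of the invasion of `a` from `R ∖ ∂R` (NTW: `τ_i = min{j : 𝓘_0[j] ∈ ∂R}`, `z = 𝓘_0[τ_i]`);
* `NTW17.plusFin k y`, `NTW17.wDom k Γ z M` — the plus cylinder as a `Finset` and
  `Λ_M ∖ B̄₁^#(z′)` (`Λ_M = ballFinset k 0 M`, the column ball `B̄_M`);
* `NTW17.wHat k Γ z M U b` — **`w(ω)`**, "the first vertex in `∂B̄₁^#(z′)` reached by the invasion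
  cluster starting from `x`": the break-out vertex of the invasion of `b` from `Λ_M ∖ B̄₁^#(z′)`;
* `NTW17.surgFin k Γ y`, `NTW17.edgesFin l` — the modified pair set `S` and the pair set `E(l)` of
  a vertex list as `Finset`s (the data `Ŝ`, `L̂` of the tree's Lemma 4.2,
  `NTW17.labelMeasure_real_le_of_affineRelabel_self`, `LabelAffineRelabel.lean`).

PROVED (deterministic, configuration-free): `0 ∈ R ∖ ∂R` and every vertex over `B_{n-1}` lies in
`insideFin` for a circuit of `Ā_{n,N}`; **`B̄₁^#(y) ∩ R ⊆ ∂R` for a column `y` of `Γ`**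
(`plusCyl_inter_inside_subset_insideBdry`: NTW's "`∂R ⊂ {dist(w̄, Γ_min) = 1}`" read for the plus
cylinder), hence no pair inside the plus cylinder touches `insideFin` or `wDom` (the locality inputs
of "`z(ω) = z(ω′)`" and of Step 2); a neighbour off the cylinder of a cylinder vertex lies in an ARM
column (`planarAdj_of_adj_of_not_mem_plusCyl`); the pairs of `Γ_z` (resp. `Γ_w`) are modified pairs
when `z ∉ Γ` (resp. `w ∉ Γ`) (`edgesOf_gammaZ_subset_surgS`, `edgesOf_gammaW_subset_surgS`: the
inclusion `L ⊆ S` of Lemma 4.2).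

What is NOT here (the Summits-side files of the lane, which import the invasion theory): the
properties of `z`, `w` along the invasion (`z ∈ ∂R`, `w` in an arm column, break-out times), the
locality of `z`, `w` under the surgery, the blocked-absorption instances, measurability, Lemma 4.1.

## Sources

* C. M. Newman, V. Tassion, W. Wu, *Critical percolation and the minimal spanning tree in slabs*,
  Comm. Pure Appl. Math. 70 (2017) 2084–2120 = arXiv:1512.09107: §4 (the stopped invasion
  `𝓘_x^n`, p. 19) and §4.1, proof of Lemma 4.1 (`τ_i`, `z(ω)`, `z′`, `τ_i^x`, `w`,
  `S(ω′) = B̄₁^#(z′) ∖ Γ_min(ω′)`), pp. 20–21 [NewmanTassionWu2017].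
* J. T. Chayes, L. Chayes, C. M. Newman, *The stochastic geometry of invasion percolation*, Comm.
  Math. Phys. 101 (1985), §3 (the break-out vertex of a finite set) [ChayesChayesNewman1985].
-/

noncomputable section

namespace Literature.Probability.Percolation

open MeasureTheory LatticeModels SimpleGraph

namespace NTW17

variable {k : ℕ}

/-! ## Small facts on the plus cylinder and on lists -/

/-- Membership in the plus cylinder is a property of the column. [cite: NewmanTassionWu2017, §4.1 (B̄₁^#(z′), the cylinder generated by B₁^#)] -/
theorem mem_plusCyl_iff {y : ℤ × ℤ} {v : slab 3 k} :
    v ∈ plusCyl k y ↔ planar k v = y ∨ planarAdj y (planar k v) := Iff.rfl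

/-- A vertex over the centre column lies in the plus cylinder. [cite: NewmanTassionWu2017, §4.1 (B̄₁^#(z′))] -/
theorem mem_plusCyl_of_planar_eq {y : ℤ × ℤ} {v : slab 3 k} (hv : planar k v = y) : v ∈ plusCyl k y :=
  Or.inl hv

/-- A vertex over an arm column lies in the plus cylinder. [cite: NewmanTassionWu2017, §4.1 (B̄₁^#(z′))] -/
theorem mem_plusCyl_of_planarAdj {y : ℤ × ℤ} {v : slab 3 k} (hv : planarAdj (planar k v) y) :
    v ∈ plusCyl k y :=
  Or.inr (planarAdj_symm hv)

/-- **Every slab neighbour of a centre-column vertex lies in the plus cylinder.**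
[cite: NewmanTassionWu2017, §4.1 (∂B̄₁^#(z′) consists of the arm columns)] -/
theorem mem_plusCyl_of_adj_of_planar_eq {y : ℤ × ℤ} {v u : slab 3 k} (hv : planar k v = y)
    (hadj : (slabGraph 3 k).Adj v u) : u ∈ plusCyl k y := by
  rcases (slab_adj_iff v u).1 hadj with ⟨-, hpa⟩ | ⟨hpe, -⟩
  · exact Or.inr (by rwa [hv] at hpa)
  · exact Or.inl (by rw [← hpe, hv])

/-- **A cylinder vertex with a neighbour off the cylinder lies in an ARM column** (the vertex
boundary `∂B̄₁^#(z′)` inside `S_k` consists of the four arm columns).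
[cite: NewmanTassionWu2017, §4.1 (proof of Lemma 4.1, "the first vertex in ∂B̄₁^#(z′) reached by the invasion")] -/
theorem planarAdj_of_adj_of_not_mem_plusCyl {y : ℤ × ℤ} {v u : slab 3 k} (hv : v ∈ plusCyl k y)
    (hu : u ∉ plusCyl k y) (hadj : (slabGraph 3 k).Adj u v) :
    planarAdj (planar k v) y ∧ planar k v ≠ y := by
  have hne : planar k v ≠ y := fun he => hu (mem_plusCyl_of_adj_of_planar_eq he hadj.symm)
  rcases mem_plusCyl_iff.1 hv with he | hpa
  · exact absurd he hne
  · exact ⟨planarAdj_symm hpa, hne⟩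

/-- The pair set of a vertex list is finite. [folklore] -/
private theorem edgesOf_finite {V : Type*} (l : List V) : (edgesOf l).Finite := by
  classical
  refine ((l.toFinset ×ˢ l.toFinset).image fun p : V × V => s(p.1, p.2)).finite_toSet.subset ?_
  rintro e ⟨a, b, l₁, l₂, hl, rfl⟩
  have ha : a ∈ l := by rw [hl]; simp
  have hb : b ∈ l := by rw [hl]; simp
  simp only [Finset.coe_image, Finset.coe_product, Set.mem_image, Set.mem_prod, Finset.mem_coe,
    List.mem_toFinset, Prod.exists]
  exact ⟨a, b, ⟨ha, hb⟩, rfl⟩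

/-- The modified pair set `S` is finite (it lies inside the plus cylinder).
[cite: NewmanTassionWu2017, §4.1 ("with s equal to the number of edges in B̄₁^#")] -/
theorem surgS_finite (Γ : List (slab 3 k)) (y : ℤ × ℤ) : (surgS k Γ y).Finite :=
  (plusEdges_finite y).subset (surgS_subset_plusEdges Γ y)

variable (k)

/-! ## The finite sets the landing data are read from -/

/-- **`R ∖ ∂R` as a finite set**: the vertices of `R ∖ ∂R` (`insideInt`) over `B_N` (all of
`R ∖ ∂R` when `Γ` is a surrounding open circuit of `Ā_{n,N}`, since then `R ⊆ B̄_N`).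
[cite: NewmanTassionWu2017, §4.1 (proof of Lemma 4.1: R(ω), ∂R, "τ_i = min{j : 𝓘_0[j] ∈ ∂R}")] -/
def insideFin (Γ : List (slab 3 k)) (N : ℕ) : Finset (slab 3 k) :=
  open scoped Classical in (ballFinset k ((0 : ℤ), (0 : ℤ)) N).filter (· ∈ insideInt k Γ)

/-- **The plus cylinder `B̄₁^#(y)` as a finite set.** [cite: NewmanTassionWu2017, §4.1 (B̄₁^#(z′))] -/
def plusFin (y : ℤ × ℤ) : Finset (slab 3 k) := (plusCyl_finite (k := k) y).toFinset

/-- **`Λ_M ∖ B̄₁^#(z′)`**: the column ball `B̄_M` with the plus cylinder about the landing column of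
`z` removed — the set whose break-out vertex for the invasion of `x` is NTW's `w` ("the first
vertex in `∂B̄₁^#(z′)` reached by the invasion cluster starting from `x`", as long as that
invasion has not left `B̄_M`). [cite: NewmanTassionWu2017, §4.1 (proof of Lemma 4.1, Step 2: τ_i^x and w)] -/
def wDom (Γ : List (slab 3 k)) (z : slab 3 k) (M : ℕ) : Finset (slab 3 k) :=
  ballFinset k ((0 : ℤ), (0 : ℤ)) M \ plusFin k (landCol k Γ z)

/-- **`z(ω)`, the first landing point on `∂R` of the invasion of `a`**: the break-out vertex of the
invasion of `a` (labels `U`) from `R ∖ ∂R` (`τ_i = min{j : 𝓘_0[j] ∈ ∂R}`, `z(ω) = 𝓘_0[τ_i]`; in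
the proof of (g1) `a = 0`, in that of (g2) `a = x`). [cite: NewmanTassionWu2017, §4.1 (proof of Lemma 4.1, τ_i and z(ω))] -/
def zHat (Γ : List (slab 3 k)) (N : ℕ) (U : Sym2 (slab 3 k) → ℝ) (a : slab 3 k) : slab 3 k :=
  Invasion.exitVertex (slabGraph 3 k) U a (insideFin k Γ N)

/-- **`w(ω)`, the first vertex of the plus cylinder `B̄₁^#(z′)` reached by the invasion of `b`**:
the break-out vertex of the invasion of `b` (labels `U`) from `Λ_M ∖ B̄₁^#(z′)`
(`τ_i^x = min{j : 𝓘_x[j] ∈ ∂B̄₁^#(z′)}`, `w = 𝓘_x[τ_i^x]`; in the proof of (g1) `b = x`).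
[cite: NewmanTassionWu2017, §4.1 (proof of Lemma 4.1, Step 2: τ_i^x and w)] -/
def wHat (Γ : List (slab 3 k)) (z : slab 3 k) (M : ℕ) (U : Sym2 (slab 3 k) → ℝ) (b : slab 3 k) :
    slab 3 k :=
  Invasion.exitVertex (slabGraph 3 k) U b (wDom k Γ z M)

/-- **The modified pair set `S` as a finite set** (the datum `Ŝ` of Lemma 4.2: "Taking
`S(ω′) = B̄₁^#(z′) ∖ Γ_min(ω′)`"). [cite: NewmanTassionWu2017, §4.1 (proof of Lemma 4.1, S(ω′))] -/
def surgFin (Γ : List (slab 3 k)) (y : ℤ × ℤ) : Finset (Sym2 (slab 3 k)) := (surgS_finite Γ y).toFinset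

/-- **The pair set `E(l)` of a vertex list as a finite set** (the lowered pairs `L = E(Γ_z)` or
`E(Γ_z) ∪ E(Γ_w)` of Lemma 4.2: "Open all the edges in `Γ_z`"). [cite: NewmanTassionWu2017, §4.1 (proof of Lemma 4.1, Steps 1–2)] -/
def edgesFin (l : List (slab 3 k)) : Finset (Sym2 (slab 3 k)) := (edgesOf_finite l).toFinset

variable {k}

/-! ## Membership lemmas -/

/-- Membership in `insideFin`. [cite: NewmanTassionWu2017, §4.1 (R ∖ ∂R)] -/
theorem mem_insideFin_iff {Γ : List (slab 3 k)} {N : ℕ} {v : slab 3 k} :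
    v ∈ insideFin k Γ N ↔ planar k v ∈ sqBox ((0 : ℤ), (0 : ℤ)) N ∧ v ∈ insideInt k Γ := by
  classical
  rw [insideFin, Finset.mem_filter, mem_ballFinset, mem_slabLift_iff]

/-- `insideFin ⊆ R ∖ ∂R`. [cite: NewmanTassionWu2017, §4.1 (R ∖ ∂R)] -/
theorem mem_insideInt_of_mem_insideFin {Γ : List (slab 3 k)} {N : ℕ} {v : slab 3 k}
    (hv : v ∈ insideFin k Γ N) : v ∈ insideInt k Γ :=
  (mem_insideFin_iff.1 hv).2

/-- `insideFin ⊆ Λ_N` (the column ball `B̄_N`). [cite: NewmanTassionWu2017, §4.1 (R ⊆ B̄_{2n_i})] -/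
theorem insideFin_subset_ballFinset (Γ : List (slab 3 k)) (N : ℕ) :
    insideFin k Γ N ⊆ ballFinset k ((0 : ℤ), (0 : ℤ)) N := by
  classical
  exact Finset.filter_subset _ _

/-- **`insideFin = R ∖ ∂R`** for a surrounding open circuit of `Ā_{n,N}` in a lattice configuration
(then `R ⊆ B̄_N`). [cite: NewmanTassionWu2017, §4.1 (R(ω) ⊆ B̄_{2n_i})] -/
theorem coe_insideFin {ω : BondConfig (slab 3 k)} (hω : ω ⊆ (slabGraph 3 k).edgeSet)
    {Γ : List (slab 3 k)} {n N : ℕ}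
    (hΓ : IsOpenCircuit k ω (slabLift k (annulus ((0 : ℤ), (0 : ℤ)) n N)) Γ)
    (hs : Surrounds k ((0 : ℤ), (0 : ℤ)) Γ) :
    ((insideFin k Γ N : Finset (slab 3 k)) : Set (slab 3 k)) = insideInt k Γ := by
  ext v
  rw [Finset.mem_coe, mem_insideFin_iff]
  constructor
  · exact fun h => h.2
  · intro h
    exact ⟨(mem_slabLift_iff k _ v).1 (inside_subset_slabLift_sqBox hω hΓ hs h.1), h⟩

/-- Membership in `R ∖ ∂R` is membership in `insideFin`, for a surrounding open circuit.
[cite: NewmanTassionWu2017, §4.1 (R ∖ ∂R)] -/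
theorem mem_insideFin_iff_mem_insideInt {ω : BondConfig (slab 3 k)} (hω : ω ⊆ (slabGraph 3 k).edgeSet)
    {Γ : List (slab 3 k)} {n N : ℕ}
    (hΓ : IsOpenCircuit k ω (slabLift k (annulus ((0 : ℤ), (0 : ℤ)) n N)) Γ)
    (hs : Surrounds k ((0 : ℤ), (0 : ℤ)) Γ) {v : slab 3 k} :
    v ∈ insideFin k Γ N ↔ v ∈ insideInt k Γ := by
  rw [← Finset.mem_coe, coe_insideFin hω hΓ hs]

/-- The columns of an open circuit of `Ā_{n,N}` avoid `B_n`, so `B_n` lies in the planar inside.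
[cite: NewmanTassionWu2017, §4.1 (B̄_{n_i} ⊆ R(ω))] -/
theorem sqBox_subset_insideP_of_isOpenCircuit {ω : BondConfig (slab 3 k)} {Γ : List (slab 3 k)}
    {n N : ℕ} (hΓ : IsOpenCircuit k ω (slabLift k (annulus ((0 : ℤ), (0 : ℤ)) n N)) Γ) :
    sqBox ((0 : ℤ), (0 : ℤ)) n ⊆ insideP k Γ := by
  refine sqBox_subset_insideP fun g hg hgn => ?_
  have := hΓ.subset g hg
  rw [mem_slabLift_iff] at this
  exact (disjoint_annulus_sqBox _ n N).le_bot ⟨this, hgn⟩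

/-- **The origin lies in `insideFin`** for an open circuit of `Ā_{n,N}`, `n ≥ 1` (the invasion
from `0` starts inside `R ∖ ∂R`). [cite: NewmanTassionWu2017, §4.1 (proof of Lemma 4.1: the invasion of 0 starts in R)] -/
theorem slabOrigin_mem_insideFin {ω : BondConfig (slab 3 k)} {Γ : List (slab 3 k)} {n N : ℕ}
    (hΓ : IsOpenCircuit k ω (slabLift k (annulus ((0 : ℤ), (0 : ℤ)) n N)) Γ) (hn : 1 ≤ n) :
    slabOrigin 3 k ∈ insideFin k Γ N := by
  rw [mem_insideFin_iff]
  refine ⟨?_, slabOrigin_mem_insideInt ((sqBox_mono _ hn).trans (sqBox_subset_insideP_of_isOpenCircuit hΓ))⟩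
  have h0 : planar k (slabOrigin 3 k) = ((0 : ℤ), (0 : ℤ)) := rfl
  rw [h0]
  exact mem_sqBox_self _ N

/-- **A vertex over `B_{n-1}` lies in `insideFin`** for an open circuit of `Ā_{n,N}` with `n ≤ N`
(NTW: `x ∈ B̄_{m_{i₀}}` and `i > i₀`, so that the invasion of `x` starts inside `R ∖ ∂R`).
[cite: NewmanTassionWu2017, §4.1 (Lemma 4.1: "Take i₀ such that x ∈ B̄_{m_{i₀}}")] -/
theorem mem_insideFin_of_planar_mem_sqBox {ω : BondConfig (slab 3 k)} {Γ : List (slab 3 k)}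
    {n N : ℕ} (hΓ : IsOpenCircuit k ω (slabLift k (annulus ((0 : ℤ), (0 : ℤ)) n N)) Γ)
    (hn : 1 ≤ n) (hnN : n ≤ N) {x : slab 3 k} (hx : planar k x ∈ sqBox ((0 : ℤ), (0 : ℤ)) (n - 1)) :
    x ∈ insideFin k Γ N := by
  rw [mem_insideFin_iff]
  refine ⟨sqBox_mono _ ((Nat.sub_le n 1).trans hnN) hx, mem_insideInt_of_planar_mem_sqBox hx ?_⟩
  rw [Nat.sub_add_cancel hn]
  exact sqBox_subset_insideP_of_isOpenCircuit hΓ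

/-- Membership in `plusFin`. [cite: NewmanTassionWu2017, §4.1 (B̄₁^#(z′))] -/
theorem mem_plusFin_iff {y : ℤ × ℤ} {v : slab 3 k} : v ∈ plusFin k y ↔ v ∈ plusCyl k y :=
  Set.Finite.mem_toFinset _

/-- Membership in `wDom = Λ_M ∖ B̄₁^#(z′)`. [cite: NewmanTassionWu2017, §4.1 (Step 2)] -/
theorem mem_wDom_iff {Γ : List (slab 3 k)} {z : slab 3 k} {M : ℕ} {v : slab 3 k} :
    v ∈ wDom k Γ z M ↔
      planar k v ∈ sqBox ((0 : ℤ), (0 : ℤ)) M ∧ v ∉ plusCyl k (landCol k Γ z) := by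
  rw [wDom, Finset.mem_sdiff, mem_ballFinset, mem_slabLift_iff, mem_plusFin_iff]

/-- `wDom ⊆ Λ_M`. [cite: NewmanTassionWu2017, §4.1 (Step 2)] -/
theorem wDom_subset_ballFinset (Γ : List (slab 3 k)) (z : slab 3 k) (M : ℕ) :
    wDom k Γ z M ⊆ ballFinset k ((0 : ℤ), (0 : ℤ)) M :=
  Finset.sdiff_subset

/-- Membership in `surgFin`. [cite: NewmanTassionWu2017, §4.1 (S(ω′))] -/
theorem mem_surgFin_iff {Γ : List (slab 3 k)} {y : ℤ × ℤ} {e : Sym2 (slab 3 k)} :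
    e ∈ surgFin k Γ y ↔ e ∈ surgS k Γ y :=
  Set.Finite.mem_toFinset _

/-- The underlying set of `surgFin` is `surgS`. [cite: NewmanTassionWu2017, §4.1 (S(ω′))] -/
theorem coe_surgFin (Γ : List (slab 3 k)) (y : ℤ × ℤ) :
    ((surgFin k Γ y : Finset _) : Set (Sym2 (slab 3 k))) = surgS k Γ y :=
  Set.Finite.coe_toFinset _

/-- Membership in `edgesFin`. [cite: NewmanTassionWu2017, §4.1 (E(Γ_z))] -/
theorem mem_edgesFin_iff {l : List (slab 3 k)} {e : Sym2 (slab 3 k)} :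
    e ∈ edgesFin k l ↔ e ∈ edgesOf l :=
  Set.Finite.mem_toFinset _

/-- The underlying set of `edgesFin` is `edgesOf`. [cite: NewmanTassionWu2017, §4.1 (E(Γ_z))] -/
theorem coe_edgesFin (l : List (slab 3 k)) :
    ((edgesFin k l : Finset _) : Set (Sym2 (slab 3 k))) = edgesOf l :=
  Set.Finite.coe_toFinset _

/-! ## The plus cylinder against the inside: `B̄₁^#(y) ∩ R ⊆ ∂R` -/

/-- **`B̄₁^#(y) ∩ R ⊆ ∂R` for a column `y` of `Γ`.**  A vertex of `R` over an arm column of `y`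
has the vertex of the centre column at its height as a slab neighbour outside `R` (the centre
column carries a vertex of `Γ`, and `R` avoids the columns of `Γ`); no vertex of `R` lies over the
centre column itself. [cite: NewmanTassionWu2017, §4.1 (proof of Lemma 4.1: ∂R ⊂ {dist(w̄, Γ_min) = 1}, z′ ∈ Γ_min with dist(z̄, z̄′) = 1)] -/
theorem plusCyl_inter_inside_subset_insideBdry {Γ : List (slab 3 k)} {y : ℤ × ℤ}
    (hy : ∃ g ∈ Γ, planar k g = y) : plusCyl k y ∩ inside k Γ ⊆ insideBdry k Γ := by
  rintro v ⟨hvP, hvR⟩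
  have hyR : y ∉ insideP k Γ := fun h => not_near_of_mem_insideP h (near_zero_iff.2 hy)
  rcases mem_plusCyl_iff.1 hvP with he | hpa
  · exact absurd (by rw [mem_inside_iff, he] at hvR; exact hvR) hyR
  · refine ⟨hvR, vtx k y (ht v), ?_, ?_⟩
    · rwa [mem_inside_iff, planar_vtx]
    · have := vtx_adj_vtx_planar (k := k) (planarAdj_symm hpa) (ht v)
      rwa [vtx_planar_ht] at this

/-- **No vertex of the plus cylinder about a column of `Γ` lies in `R ∖ ∂R`.**
[cite: NewmanTassionWu2017, §4.1 (proof of Lemma 4.1: ∂R and B̄₁^#(z′))] -/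
theorem not_mem_insideInt_of_mem_plusCyl {Γ : List (slab 3 k)} {y : ℤ × ℤ}
    (hy : ∃ g ∈ Γ, planar k g = y) {v : slab 3 k} (hv : v ∈ plusCyl k y) : v ∉ insideInt k Γ :=
  fun h => h.2 (plusCyl_inter_inside_subset_insideBdry hy ⟨hv, h.1⟩)

/-- **No pair inside the plus cylinder about a column of `Γ` touches `insideFin`** (so the labels
of the pairs read by the invasion of `0` up to its landing on `∂R` are untouched by the surgery:
"one can explore `𝓘_0^{m_i}(ω′)` until it contains `z`, without any change from `𝓘_0^{m_i}(ω)`").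
[cite: NewmanTassionWu2017, §4.1 (proof of Lemma 4.1, recovery Step 1: ω|_R = ω′|_R, z(ω) = z(ω′))] -/
theorem not_mem_insideFin_of_mem_plusEdges {Γ : List (slab 3 k)} {y : ℤ × ℤ}
    (hy : ∃ g ∈ Γ, planar k g = y) {N : ℕ} {e : Sym2 (slab 3 k)} (he : e ∈ plusEdges k y)
    {v : slab 3 k} (hv : v ∈ e) : v ∉ insideFin k Γ N := fun h =>
  not_mem_insideInt_of_mem_plusCyl hy (he.2 v hv) (mem_insideInt_of_mem_insideFin h)

/-- No pair inside the plus cylinder about the landing column touches `wDom`.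
[cite: NewmanTassionWu2017, §4.1 (proof of Lemma 4.1, Step 2: the invasion of x before it touches B̄₁^#(z′))] -/
theorem not_mem_wDom_of_mem_plusEdges {Γ : List (slab 3 k)} {z : slab 3 k} {M : ℕ}
    {e : Sym2 (slab 3 k)} (he : e ∈ plusEdges k (landCol k Γ z)) {v : slab 3 k} (hv : v ∈ e) :
    v ∉ wDom k Γ z M := fun h =>
  (mem_wDom_iff.1 h).2 (he.2 v hv)

/-- Agreement off the plus pairs gives agreement on the graph pairs at the vertices of `insideFin`
(the hypothesis shape of the lane's locality lemmas `…_congr_of_agree_adj`).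
[cite: NewmanTassionWu2017, §4.1 (proof of Lemma 4.1, recovery Step 1)] -/
theorem agree_adj_insideFin_of_agree_off_plusEdges {Γ : List (slab 3 k)} {y : ℤ × ℤ}
    (hy : ∃ g ∈ Γ, planar k g = y) {N : ℕ} {U U' : Sym2 (slab 3 k) → ℝ}
    (h : ∀ e, e ∉ plusEdges k y → U e = U' e) :
    ∀ v ∈ insideFin k Γ N, ∀ u, (slabGraph 3 k).Adj v u → U s(v, u) = U' s(v, u) :=
  fun _ hv _ _ => h _ fun he => not_mem_insideFin_of_mem_plusEdges hy he (Sym2.mem_mk_left _ _) hv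

/-- Agreement off the plus pairs gives agreement on the graph pairs at the vertices of `wDom`.
[cite: NewmanTassionWu2017, §4.1 (proof of Lemma 4.1, Step 2)] -/
theorem agree_adj_wDom_of_agree_off_plusEdges {Γ : List (slab 3 k)} {z : slab 3 k} {M : ℕ}
    {U U' : Sym2 (slab 3 k) → ℝ} (h : ∀ e, e ∉ plusEdges k (landCol k Γ z) → U e = U' e) :
    ∀ v ∈ wDom k Γ z M, ∀ u, (slabGraph 3 k).Adj v u → U s(v, u) = U' s(v, u) :=
  fun _ hv _ _ => h _ fun he => not_mem_wDom_of_mem_plusEdges he (Sym2.mem_mk_left _ _) hv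

/-! ## The lowered pairs are modified pairs: `E(Γ_z) ⊆ S`, `E(Γ_w) ⊆ S` -/

section Lowered

variable {L Γ : List (slab 3 k)} {y : ℤ × ℤ} {u g : slab 3 k}

/-- The first vertex of a consecutive pair of a connector is its head or an inner vertex (hence
off the target list). [cite: NewmanTassionWu2017, §4.1 (Γ_z touches Γ_min only at its end)] -/
theorem eq_or_not_mem_of_connector_eq (hg : nearestOver k L y (ht u) = some g)
    (huy : planar k u ≠ y) {a b : slab 3 k} {l₁ l₂ : List (slab 3 k)}
    (hl : connector k L y u = l₁ ++ a :: b :: l₂) : a = u ∨ a ∉ L := by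
  cases l₁ with
  | nil =>
    left
    have hhead := connector_head L y u
    have ha : (connector k L y u).head (connector_ne_nil L y u) = a := by
      simp only [hl, List.nil_append, List.head_cons]
    rw [hhead] at ha
    exact ha.symm
  | cons c l₁ => exact Or.inr (inner_connector hg huy hl (List.cons_ne_nil c l₁) (List.cons_ne_nil b l₂)).2.1

/-- **The pairs of `Γ_z` are modified pairs** when `z ∉ Γ` (each contains `z` or an inner vertex
of `Γ_z`, both off `Γ`): the inclusion `L ⊆ S` of Lemma 4.2 for Steps 1 and 3.
[cite: NewmanTassionWu2017, §4.1 (proof of Lemma 4.1: "except for the edges of Γ_min(ω) ∪ Γ_z ∪ Γ_w")] -/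
theorem edgesOf_gammaZ_subset_surgS {z : slab 3 k} (hz : ∃ g ∈ Γ, planarAdj (planar k z) (planar k g))
    (hzΓ : z ∉ Γ) : edgesOf (gammaZ k Γ z) ⊆ surgS k Γ (landCol k Γ z) := by
  obtain ⟨g, hg⟩ := exists_nearestOver_gammaZ hz
  rintro e ⟨a, b, l₁, l₂, hl, rfl⟩
  refine ⟨edgesOf_connector_subset hg (landCol_spec hz).2 (mem_edgesOf_of_eq hl), a,
    Sym2.mem_mk_left _ _, ?_⟩
  rcases eq_or_not_mem_of_connector_eq hg (planar_ne_landCol hz) hl with rfl | ha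
  · exact hzΓ
  · exact ha

/-- A point planar-adjacent to `y` is not `y`. [folklore] -/
private theorem ne_of_planarAdj_left {q y : ℤ × ℤ} (h : planarAdj q y) : q ≠ y := by
  rintro rfl
  obtain ⟨a, b⟩ := q
  simp only [planarAdj, Prod.mk_add_mk, Prod.mk.injEq] at h
  omega

/-- **The pairs of `Γ_w` are modified pairs** when `w ∉ Γ` (and `w` lies in an arm column): the
inclusion `L ⊆ S` of Lemma 4.2 for Step 2. [cite: NewmanTassionWu2017, §4.1 (proof of Lemma 4.1: "except for the edges of Γ_min(ω) ∪ Γ_z ∪ Γ_w")] -/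
theorem edgesOf_gammaW_subset_surgS {z w : slab 3 k} (hz : ∃ g ∈ Γ, planarAdj (planar k z) (planar k g))
    (hw : planarAdj (planar k w) (landCol k Γ z)) (hwΓ : w ∉ Γ) :
    edgesOf (gammaW k Γ z w) ⊆ surgS k Γ (landCol k Γ z) := by
  obtain ⟨g, hg⟩ := exists_nearestOver_gammaW (w := w) hz
  rintro e ⟨a, b, l₁, l₂, hl, rfl⟩
  refine ⟨edgesOf_connector_subset hg hw (mem_edgesOf_of_eq hl), a, Sym2.mem_mk_left _ _, ?_⟩
  rcases eq_or_not_mem_of_connector_eq hg (ne_of_planarAdj_left hw) hl with rfl | ha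
  · exact hwΓ
  · exact fun haΓ => ha (List.mem_append_right _ haΓ)

end Lowered

end NTW17

end Literature.Probability.Percolation
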